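import Summits.RiemannHypothesis.RiemannHypothesis.Theorems.SignConeGradedFamily

/-!
# The graded families of the sign-cone criterion — the near-clean and far-confinement SHADOWS
(cell `SignConeInequality`, item stmt-RiemannHypothesis-16301; lead-of-record file; continues `Theorems/SignConeGradedFamily.lean`)

* `NearCleanRung t₀` (negativity only below `t₀`): `t₀ = log 2` IS `SignConeFarField` (`Iff.rfl`); antitone; every rung `⇐ X`;
  `nearCleanRung_of_gapRung : ⌊e^{t₀}⌋ ≤ m + 1 → GapRung m → NearCleanRung t₀`; `X ↔ ∀ t₀` (`F` vanishes beyond `2a`).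
* `FarConfinedRung s` (crux strategist s1's far-confinement ladder; negativity only at `|t| ≥ s`): monotone; `s ≤ log 2` is `X`;
  top = the closed far-field item at each cutoff (`farConfinedAt_of_lt : 2a < s → FarConfinedAt s a`); `⇐` gap confinement.
-/

noncomputable section

-- `Summit.RiemannHypothesis.RiemannHypothesis.…` repeats a namespace component by design (D-0017 layout).
set_option linter.dupNamespace false

open scoped BigOperators ComplexConjugate
open Complex MeasureTheory Set Filter

namespace Summit.RiemannHypothesis.RiemannHypothesis.Theorems.SignCone

open Literature.NumberTheory.LFunctions
open Summit.RiemannHypothesis.RiemannHypothesis.Theses.SignCone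
open Summit.RiemannHypothesis.RiemannHypothesis.Theorems.SignConeFarField (SignConeFarField_of)

/-! ## The near-clean and far-confinement shadows -/

/-- `NearCleanRung (log 2)` IS the far-field item, verbatim. [folklore] -/
theorem nearCleanRung_log_two_iff_signConeFarField : NearCleanRung (Real.log 2) ↔ SignConeFarField :=
  Iff.rfl

/-- The near-clean ladder is antitone in `t₀`: a larger `t₀` leaves more room for negativity (a larger class),
so the higher rung implies the lower one. [folklore] -/
theorem nearCleanRung_anti {t₀ t₁ : ℝ} (h : t₀ ≤ t₁) (h₁ : NearCleanRung t₁) : NearCleanRung t₀ :=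
  fun a ha k g hg hn hclean => h₁ a ha k g hg hn (fun t ht => hclean t (h.trans ht))

/-- Every near-clean rung is implied by the crux. [folklore] -/
theorem nearCleanRung_of_signConeInequality (h : SignConeInequality) (t₀ : ℝ) : NearCleanRung t₀ :=
  fun a ha k g hg hn _ => h a ha k g hg hn

/-- **Near-clean classes are gap-confined**: negativity only below `t₀` lies in the gaps `n = 2, …, ⌊e^{t₀}⌋`,
so `GapRung m → NearCleanRung t₀` whenever `⌊e^{t₀}⌋ ≤ m + 1` (e.g. `GapRung 1 → NearCleanRung (log 3)`). [folklore] -/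
theorem nearCleanRung_of_gapRung {t₀ : ℝ} {m : ℕ} (ht₀ : ⌊Real.exp t₀⌋₊ ≤ m + 1) (hm : GapRung m) :
    NearCleanRung t₀ := by
  intro a ha k g hg F hn hclean
  have hcard : (Finset.Icc 2 ⌊Real.exp t₀⌋₊).card ≤ m := by rw [Nat.card_Icc]; omega
  refine gapRung_iff_forall_gapConfinedAt.1 hm _ hcard a ha k g hg hn (fun t ht hneg => ?_)
  have hF : F = fun t => ∑ i, weilConv (g i) (weilReflect (g i)) t := rfl
  obtain ⟨hn2, hlo, hhi⟩ := gap_of_re_neg (g := g) hF hn ht hneg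
  refine ⟨⌊Real.exp |t|⌋₊, Finset.mem_Icc.2 ⟨hn2, Nat.floor_le_floor ?_⟩, hlo.le, hhi⟩
  refine Real.exp_le_exp.2 (le_of_lt (not_le.1 fun hle => ?_))
  exact absurd (hclean t hle) (not_le.2 hneg)

/-- **`X_∞ = X` for the near-clean ladder**: at cutoff `a` the rung `t₀ = 2a` (indeed any `t₀ > 2a`) is `X_a`,
because `F` vanishes beyond `2a`. [folklore] -/
theorem signConeInequality_iff_forall_nearCleanRung : SignConeInequality ↔ ∀ t₀ : ℝ, NearCleanRung t₀ := by
  refine ⟨nearCleanRung_of_signConeInequality, fun h => ?_⟩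
  intro a ha k g hg F hn
  refine h (2 * a + 1) a ha k g hg hn (fun t ht => ?_)
  have h0 : F t = 0 := autocorrSum_eq_zero_of_lt (k := k) g (fun i => (hg i).2) (t := t) (by linarith)
  have h1 : (F t).re = 0 := by rw [h0, Complex.zero_re]
  exact le_of_eq h1.symm

/-- Every far-confinement rung is implied by the crux. [folklore] -/
theorem farConfinedRung_of_signConeInequality (h : SignConeInequality) (s : ℝ) : FarConfinedRung s :=
  fun a ha k g hg hn _ => h a ha k g hg hn

/-- The far-confinement ladder is monotone in `s`. [folklore] -/
theorem farConfinedRung_mono {s s' : ℝ} (h : s ≤ s') (hs : FarConfinedRung s) : FarConfinedRung s' :=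
  fun a ha k g hg hn hconf => hs a ha k g hg hn (fun t ht hts => hconf t ht (hts.trans_le h))

/-- **`X_∞ = X` for the far-confinement ladder**: at `s ≤ log 2` the confinement hypothesis is vacuous. [folklore] -/
theorem farConfinedRung_iff_of_le_log_two {s : ℝ} (hs : s ≤ Real.log 2) : FarConfinedRung s ↔ SignConeInequality :=
  ⟨fun h a ha k g hg hn => h a ha k g hg hn (fun _t ht hlt => absurd (hlt.trans_le hs) (not_lt.2 ht)),
   fun h => farConfinedRung_of_signConeInequality h s⟩

/-- **The top of the far-confinement ladder is the far-field item**: at cutoff `a` with `2a < s` the confinement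
hypothesis covers the whole support of `F`. [folklore] -/
theorem farConfinedAt_of_lt {s a : ℝ} (ha : 0 < a) (h2a : 2 * a < s) : FarConfinedAt s a := by
  intro k g hg F hn hconf
  refine SignConeFarField_of a ha k g hg hn (fun t ht => ?_)
  by_cases hts : |t| < s
  · exact hconf t ht hts
  · have h0 : F t = 0 :=
      autocorrSum_eq_zero_of_lt (k := k) g (fun i => (hg i).2) (t := t) (by linarith [not_lt.1 hts])
    have h1 : (F t).re = 0 := by rw [h0, Complex.zero_re]
    exact le_of_eq h1.symm

/-- Far-confined classes are gap-confined at each cutoff: negativity only at `s ≤ |t| ≤ 2a` lies in the gaps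
`n = ⌊e^{s}⌋, …, ⌊e^{2a}⌋`. [folklore] -/
theorem farConfinedAt_of_gapConfinedAt {s a : ℝ}
    (h : GapConfinedAt (Finset.Icc (max 2 ⌊Real.exp s⌋₊) ⌊Real.exp (2 * a)⌋₊) a) : FarConfinedAt s a := by
  intro k g hg F hn hconf
  refine h k g hg hn (fun t ht hneg => ?_)
  have hF : F = fun t => ∑ i, weilConv (g i) (weilReflect (g i)) t := rfl
  obtain ⟨hn2, hlo, hhi⟩ := gap_of_re_neg (g := g) hF hn ht hneg
  have hst : s ≤ |t| := not_lt.1 fun hlt => absurd (hconf t ht hlt) (not_le.2 hneg)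
  have ht2a : |t| ≤ 2 * a := not_lt.1 fun hlt => by
    have h0 : F t = 0 := autocorrSum_eq_zero_of_lt (k := k) g (fun i => (hg i).2) (t := t) hlt
    have hneg' : (F t).re < 0 := hneg
    rw [h0, Complex.zero_re] at hneg'
    exact lt_irrefl _ hneg'
  refine ⟨⌊Real.exp |t|⌋₊, Finset.mem_Icc.2 ⟨max_le hn2 (Nat.floor_le_floor (Real.exp_le_exp.2 hst)),
    Nat.floor_le_floor (Real.exp_le_exp.2 ht2a)⟩, hlo.le, hhi⟩

end Summit.RiemannHypothesis.RiemannHypothesis.Theorems.SignCone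

end
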